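import Summits.HodgeConjecture.HodgeConjecture.Cruxes.H413.Lines.R90_S5_BaseChangeSpineA
import Summits.HodgeConjecture.HodgeConjecture.Cruxes.H413.Lines.F0_P3c_S2SharpPaydown
import Summits.HodgeConjecture.HodgeConjecture.Theorems.F0P3AntiholCohUnitaryToken
import HarnessLib

/-!
# R90-TF S5, file B «GlobalPacketFin» (ED. 2 — docstring page locators per QA lit4 (1791)(a)∕(1795); declarations byte-identical to ED. 1) — the PROVED composition SPINE ⟹ FIN (organ `stub_S2fin` of L2 `stub_S2sharp`), and SPINE ∧ Ξ∞ ⟹ S2♯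

R90-TF section S5 «Ch13.3-mult∕rigidity» (R90-C133), file B `Cruxes/H413/Lines/R90_S5_GlobalPacketFinB.lean` (R90-TF LEAD #1 L1 14:56:35Z: «S5-typ2: FIN `S2FinLetter`
composition over the spine, PROVED `s2Fin_of_spine`»; typed by S5-typ1 = K2E1-typ1 (g0) because the S5-typ2 seat (LH7-typ1) closed 14:47:59Z; namespace
`Summit.HodgeConjecture.HodgeConjecture.R90.S5`).  PROGRAMME LAW C3 «JUNCTION»: this is the proved composition of the S5 spine socket
`stub_R90_1336c_membership : XiMembershipOfArchJLetter` (file A `R90_S5_BaseChangeSpineA`) into its parent DAG root, the organ FIN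
`F0P3cS2SharpPaydown.S2FinLetter` (`Cruxes/H413/Lines/F0_P3c_S2SharpPaydown.lean` ED. 5, def :114, stub `stub_S2fin` :348).

CONTENT (no `sorry` in this file; `sorryAx` enters only through the cited sockets, TRIO otherwise):
* §1 `s2Fin_of_spine : XiMembershipOfArchJLetter → S2FinLetter` — PROVED.  FIN's own token `(M, σK, σ𝔤, T₁, δ)` is DISCARDED: a cotangent `P` (hol or antihol at the
  CM frame, `H` definite off `ι`, `[L⁺:ℚ] ≥ 2`) has a COH-UNITARY token `r` (★ `F0P3AntiholCohUnitaryToken.exists_cohUnitaryToken_of_isCot_cpt`, Prop 15.2.1 (b) ∕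
  Borel–Wallach VI.4.11 in the tree), that token is cohomological in some degree-one type `δ′` (★ «Tok» `F0P3cArchTokenCohomological.exists_upqTypeClasses_ne_bot_of_token_cpt`),
  and the spine's read-back `xiMembership_of_cohUnitaryToken` (★ `ofModule_eq_archDegOneClass`: such a token has class `[J^δ′]`) gives `ξ`.
* §2 `stub_S2fin_of_spine : S2FinLetter := s2Fin_of_spine stub_R90_1336c_membership` — FIN PAID modulo the ONE S5 socket (replaces the organ's own `sorry` for
  every consumer that imports this file instead of re-sorrying FIN).
* §3 `s2sharp_of_spine_qpsi : XiMembershipOfArchJLetter → S2QpsiLetter → cohDiscrete_memXiFamily_archPinned` — PROVED: the closer L2 `stub_S2sharp` from the S5 socket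
  and the S2 organ Ξ∞ alone, through the paydown's PROVED head `stub_S2sharp_of_organs` with CENTRAL-ι ★ `s2CentralIota_holds`, CASIMIR-ι∕-τ from Ξ∞ (the paydown's
  three-line derivations with the HYPOTHESIS `hQ` in place of `stub_S2qpsi`) and PIN-τ ★ `F0P3cPinCompactChi.pinCompact_of_casimirTau`.  Junction for S2
  (`R90_S2_ArchPacketXiA`): its PROVED `s2Qpsi_of_sigmas` composed with §3 pays `stub_S2sharp` modulo {S5 socket, S2 sockets}.

GREEN CONTRACT: `lean check --json` rc 0, errors [], sorries 0 IN THIS FILE; audit: `s2Fin_of_spine`, `s2sharp_of_spine_qpsi`, `casimirIota_of_qpsi`, `casimirTau_of_qpsi`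
TRIO-only (`propext`, `Classical.choice`, `Quot.sound`); `stub_S2fin_of_spine` carries `sorryAx` through `stub_R90_1336c_membership` only.  No instance, no notation,
nothing restated: every letter is cited BY NAME (C2∕C4).

HONEST LABEL: HC_CM is proved only modulo the 7 printed citations (2 remaining named inputs: hLiu418 = stmt-HodgeConjecture-24832, h413 = stmt-HodgeConjecture-24833)
until rung 0 closes.  This file moves FIN's `sorry` onto the S5 socket; it does not discharge it.

References: [cite: Rogawski1990, Thm. 13.3.6 (c) (p. 202); §14.6 Thm. 14.6.4 (p. 243); Prop. 15.2.1 (b) (p. 250); §15.3 ¶1 (p. 249)]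
[cite: BorelWallach2000, VI Thm. 4.11; II Cor. 3.3] [cite: Marshall2014, §3.3; §4.1]
-/

set_option autoImplicit false
set_option linter.dupNamespace false

noncomputable section

open NumberField IsDedekindDomain MeasureTheory
open scoped Matrix ComplexOrder

namespace Summit.HodgeConjecture.HodgeConjecture.R90.S5

open Literature.NumberTheory.Automorphic Literature.NumberTheory.Automorphic.UnitaryGroup
open Literature.NumberTheory.Automorphic.UnitaryGroup.CotangentForms
open Literature.NumberTheory.GaloisRepresentations
open Literature.NumberTheory.Rogawski1990
open Literature.RepresentationTheory Literature.RepresentationTheory.BorelWallach2000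
open Literature.RepresentationTheory.KonnoKonno2007 Literature.RepresentationTheory.KonnoKonno2007.RealDualPair
open Literature.RepresentationTheory.KonnoKonno2007.RealDualPair.UForm
open Summit.HodgeConjecture.HodgeConjecture.Cruxes.H413
open Summit.HodgeConjecture.HodgeConjecture.Cruxes.H413.F0P3cS2SharpPaydown
open Summit.HodgeConjecture.HodgeConjecture.Cruxes.H413.F0P3bArchDegOnePackage (IsCohUnitaryIrrep)

/-! ## §1 SPINE ⟹ FIN (proved) -/

/-- **FIN from the S5 spine socket.**  For a cotangent `P` the letter's token `(M, σK, σ𝔤, T₁, δ)` is not needed: `P` has a coh-unitary token `r`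
(★ `exists_cohUnitaryToken_of_isCot_cpt`), `r` has a non-zero degree-one class of some type `δ′ = ±1` (★ «Tok» `exists_upqTypeClasses_ne_bot_of_token_cpt`), hence
class `[J^δ′]` (★ `ofModule_eq_archDegOneClass`, inside the spine's read-back), and the spine socket (§15.3 ¶1 ∕ Thm 13.3.6 (c) + Thm 14.6.4) produces `ξ` with
`MemXiFamily P … ξ`. [cite: Rogawski1990, §15.3 ¶1 (p. 249); Thm. 13.3.6 (c) (p. 202); Prop. 15.2.1 (b) (p. 250)] [cite: BorelWallach2000, VI Thm. 4.11] -/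
theorem s2Fin_of_spine (hG : XiMembershipOfArchJLetter) : S2FinLetter := by
  intro L _ _ _ ι H T hT hdef h2 μ _ μω hμu hμω P hP _hKc M _ _ σK σ𝔤 hM hirr htok δ hδ hne
  obtain ⟨r, ⟨T₁, hT₁K, hT₁𝔤, hT₁⟩, hr⟩ :=
    F0P3AntiholCohUnitaryToken.exists_cohUnitaryToken_of_isCot_cpt L H ι T hT μ hdef h2 P hP
  obtain ⟨δ', hδ', hne'⟩ :=
    F0P3cArchTokenCohomological.exists_upqTypeClasses_ne_bot_of_token_cpt L ι H T hT μ hdef h2 P hP hr.gk hr.irred T₁ hT₁K hT₁𝔤 hT₁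
  exact xiMembership_of_cohUnitaryToken hG L ι H T hT hdef h2 μ μω hμu hμω P r.V r.ρK r.ρ𝔤 hr ⟨T₁, hT₁K, hT₁𝔤, hT₁⟩ δ' hδ' hne'

/-! ## §2 FIN paid modulo the S5 socket -/

/-- **Organ FIN, PAID modulo `stub_R90_1336c_membership`** (the only `sorryAx` on this declaration's axiom list). [cite: Rogawski1990, §15.3 ¶1 (p. 249); Thm. 13.3.6 (c) (p. 202)] -/
theorem stub_S2fin_of_spine : S2FinLetter :=
  s2Fin_of_spine stub_R90_1336c_membership

/-! ## §3 SPINE ∧ Ξ∞ ⟹ S2♯ (proved; the junction S2 composes with) -/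

/-- CASIMIR-ι from a HYPOTHESIS Ξ∞ (the paydown's `casimirIota_holds` with `hQ` in place of `stub_S2qpsi`): `qψ ι = ±1` + the in-house central identity at `ι`
(★ `F0P3cXiCentralAllPlaces.sq_sum_eq_two_iff_qψ_of_split` over ★ `F0P3cXiCentralCharSplit.xiCentralCharSplit`). [cite: Rogawski1990, §12.3 p. 178; Thm. 13.3.5 (p. 202)] -/
theorem casimirIota_of_qpsi (hQ : S2QpsiLetter) : S2CasimirIotaLetter := by
  intro L _ _ _ ι H T hT hdef h2 μ _ μω hμu hμω P hP M _ _ σK σ𝔤 hM hirr htok ξ hmem a b c habc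
  exact (F0P3cXiCentralAllPlaces.sq_sum_eq_two_iff_qψ_of_split F0P3cXiCentralCharSplit.xiCentralCharSplit
    L ι H T hT hdef h2 μ μω hμu hμω P hP ξ hmem ι a b c habc).mpr (hQ L ι H T hT hdef h2 μ μω hμu hμω P hP ξ hmem ι)

/-- CASIMIR-τ from a HYPOTHESIS Ξ∞ (the paydown's `casimirTau_holds` with `hQ` in place of `stub_S2qpsi`). [cite: Rogawski1990, §12.3 p. 178; Thm. 13.3.5 (p. 202)] -/
theorem casimirTau_of_qpsi (hQ : S2QpsiLetter) : S2CasimirTauLetter := by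
  intro L _ _ _ ι H T hT hdef h2 μ _ μω hμu hμω P hP hKc ξ hmem τ hτ a b c habc
  exact (F0P3cXiCentralAllPlaces.sq_sum_eq_two_iff_qψ_of_split F0P3cXiCentralCharSplit.xiCentralCharSplit
    L ι H T hT hdef h2 μ μω hμu hμω P hP ξ hmem τ a b c habc).mpr (hQ L ι H T hT hdef h2 μ μω hμu hμω P hP ξ hmem τ)

/-- **L2 `stub_S2sharp`'s letter from the S5 socket and Ξ∞ alone** (paydown HEAD ★ `stub_S2sharp_of_organs` with CENTRAL-ι ★ `s2CentralIota_holds`, CASIMIR-ι∕-τ from `hQ`,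
PIN-τ ★ `F0P3cPinCompactChi.pinCompact_of_casimirTau`). [cite: Rogawski1990, §14.6 Thm. 14.6.4 (p. 243); Prop. 15.2.1 (b) (p. 250)] [cite: Marshall2014, §3.3; §4.1] -/
theorem s2sharp_of_spine_qpsi (hG : XiMembershipOfArchJLetter) (hQ : S2QpsiLetter) :
    Literature.NumberTheory.Rogawski1990.cohDiscrete_memXiFamily_archPinned :=
  stub_S2sharp_of_organs (s2Fin_of_spine hG) s2CentralIota_holds (casimirIota_of_qpsi hQ)
    (F0P3cPinCompactChi.pinCompact_of_casimirTau (casimirTau_of_qpsi hQ))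

/-! ## §4 (ED. 3) THREAD-₃ link (3): SPINE₃ ⟹ FIN₃, FIN₃ PAID modulo the `₃` socket, SPINE₃ ∧ Ξ∞ ⟹ S2♯₃
EDITION LOG — ED. 3 (heir LEAD (R-44)(C)(3); S5 dealer R90-C133-plan (g3) deal (H24); typist-of-draft R90-C133-p03 (g3), typist of record K2E1-typ1; BASEGUARD ED. 2
ef90279e5d46534a): ADDITIONS ONLY — lines 1–100 = ED. 2 byte for byte, imports unchanged (the `₃` letters `S2FinLetter₃` ∕ `S2SharpLetter₃` ∕ `stub_S2sharp_of_organs₃` come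
from the SAME leaf module, ED. 6), this one trailing section with exactly three theorems; B does NOT import A3 (`R90_S5_ArchJLettersA3`): the `H¹`-trigger read-back is
inlined (★ `ofModule_eq_archDegOneClass`).  No `sorry` in this file: `s2Fin₃_of_spine₃`, `s2sharp₃_of_spine₃_qpsi` TRIO; `stub_S2fin₃_of_spine₃` carries `sorryAx` through
A's ON-PATH socket `stub_R90_1336c_membership₃` (:254) only.  WHY `3 ≤ [L⁺:ℚ]`: the R90-TF road pays FIN from the Arthur-simple trace formula, which needs two compact real
places; «`3 ≤ [F⁺:ℚ]` is implied by Hyp413 (`6 ≤ [F:ℚ]`); the weakening costs nothing at the summit; anchor [Rogawski1990 §13.3 (13.3.6(c)), two compact places]» (director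
s2043 (iii)).  HONEST LABEL: this edition moves FIN₃'s debt onto the `₃` socket; it discharges nothing; HC_CM is proved only modulo the 7 printed citations (2 remaining named
inputs: hLiu418 = stmt-HodgeConjecture-24832, h413 = stmt-HodgeConjecture-24833) until rung 0 closes. -/

section Thread3

open Summit.HodgeConjecture.HodgeConjecture.Cruxes.H413.F0P3bArchDegOneClass (ofModule_eq_archDegOneClass)

/-- **FIN₃ from the S5 `₃` spine socket** — §1's proof with `h3` threaded: a cotangent `P` has a coh-unitary token `r` (★ `exists_cohUnitaryToken_of_isCot_cpt`) with a non-zero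
degree-one class of some type `δ′ = ±1` (★ `exists_upqTypeClasses_ne_bot_of_token_cpt`), hence class `[J^δ′]` (★ `ofModule_eq_archDegOneClass`), and the `₃` letter
`XiMembershipOfArchJLetter₃` (two compact places, `3 ≤ [L⁺:ℚ]`) produces `ξ` with `MemXiFamily P … ξ`.  (The read-back is inlined: B does not import A3.)
[cite: Rogawski1990, §15.3 ¶1 (p. 249); Thm. 13.3.6 (c) (p. 202); Prop. 15.2.1 (b) (p. 250)] [cite: BorelWallach2000, VI Thm. 4.11] -/
theorem s2Fin₃_of_spine₃ (hG : XiMembershipOfArchJLetter₃) : S2FinLetter₃ := by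
  intro L _ _ _ ι H T hT hdef h2 h3 μ _ μω hμu hμω P hP _hKc M _ _ σK σ𝔤 hM hirr htok δ hδ hne
  obtain ⟨r, ⟨T₁, hT₁K, hT₁𝔤, hT₁⟩, hr⟩ :=
    F0P3AntiholCohUnitaryToken.exists_cohUnitaryToken_of_isCot_cpt L H ι T hT μ hdef h2 P hP
  obtain ⟨δ', hδ', hne'⟩ :=
    F0P3cArchTokenCohomological.exists_upqTypeClasses_ne_bot_of_token_cpt L ι H T hT μ hdef h2 P hP hr.gk hr.irred T₁ hT₁K hT₁𝔤 hT₁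
  exact hG L ι H T hT hdef h2 h3 μ μω hμu hμω P r.V r.ρK r.ρ𝔤 hr ⟨T₁, hT₁K, hT₁𝔤, hT₁⟩ δ' hδ' (ofModule_eq_archDegOneClass r.ρK r.ρ𝔤 hr δ' hδ' hne')

/-- **Organ FIN₃, PAID modulo `stub_R90_1336c_membership₃`** (the ON-PATH `₃` socket of the spine; the only `sorryAx` on this declaration's axiom list).
[cite: Rogawski1990, §15.3 ¶1 (p. 249); Thm. 13.3.6 (c) (p. 202)] -/
theorem stub_S2fin₃_of_spine₃ : S2FinLetter₃ :=
  s2Fin₃_of_spine₃ stub_R90_1336c_membership₃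

/-- **The closer's `stub_S2sharp₃` TYPE from the `₃` spine socket and Ξ∞ alone** (leaf ED. 6 head `stub_S2sharp_of_organs₃` with CENTRAL-ι ★ `s2CentralIota_holds`, CASIMIR-ι∕-τ from `hQ`
(§3), PIN-τ ★ `F0P3cPinCompactChi.pinCompact_of_casimirTau`). [cite: Rogawski1990, §14.6 Thm. 14.6.4 (p. 243); Prop. 15.2.1 (b) (p. 250)] [cite: Marshall2014, §3.3; §4.1] -/
theorem s2sharp₃_of_spine₃_qpsi (hG : XiMembershipOfArchJLetter₃) (hQ : S2QpsiLetter) : S2SharpLetter₃ :=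
  stub_S2sharp_of_organs₃ (s2Fin₃_of_spine₃ hG) s2CentralIota_holds (casimirIota_of_qpsi hQ)
    (F0P3cPinCompactChi.pinCompact_of_casimirTau (casimirTau_of_qpsi hQ))

end Thread3

end Summit.HodgeConjecture.HodgeConjecture.R90.S5

end
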